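import Mathlib
import Summits.KontsevichZagierPeriods.KontsevichZagierPeriods.Theorems.SoloInformedQShLabels
import Summits.KontsevichZagierPeriods.KontsevichZagierPeriods.Theorems.SoloInformedKZStokesSimplexCells
import HarnessLib
import HarnessLib.Audit

/-!
# SoloInformed — the harmonic product of two words by naive moves (PROGRAMME XLVII, file 4)

Solo programme `solo-KontsevichZagierPeriods-informed`, session s47.

For admissible `u = (u₀,…,u_k)` and `v = (v₀,…,v_{k'})` of weights `m+1`, `m'+1` let
`M + 1 = (m+1) + (m'+1)`. In `𝒫 = KZ.FormalPeriodRing`: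

* `HProd2 = CubeW u × CubeW v` (rule (2), Fubini) has class `mzvClass u · mzvClass v` and integrand
  `G(Q) · G(R)` with `Q`, `R` the chains of block-end prefix products of the two halves
  (`soloInformed_hProd2_class`, `soloInformed_hProd2_integrand`);
* for every quasi-shuffle word `ω ∈ QSh (k+1) (k'+1)` the labelling `LabW ω` of `Fin (M+1)` (a
  `u`-coordinate of block `s` ↦ the position of the step consuming `u`-block `s`, same for `v`) is
  a valid block labelling; its representation `HTerm ω = BRep (LabW ω)` has integrand
  `G(chain_ω(Q, R))` and class `mzvClass (idxW u v ω)` (`soloInformed_hTerm_integrand`,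
  `soloInformed_hTerm_class`);
* the two-chain identity `Σ_ω G(chain_ω(Q,R)) = G(Q)G(R)` (file 2) is rule (1b) pointwise on the
  cube, whence the **raw harmonic product formula**

  `mzvClass u · mzvClass v = Σ_{ω ∈ QSh (k+1) (k'+1)} mzvClass (idxW u v ω)`

  (`soloInformed_mzvClass_mul_qSh_raw`); file 5 identifies the right-hand side with Hoffman's
  stuffle product `u ∗ v` of the Literature.

References: Hoffman 1997 §2; Kontsevich–Zagier 2001 §1.2.
-/

noncomputable section

open Set MeasureTheory Finset
open Literature.NumberTheory.Transcendental
open Literature.NumberTheory.Transcendental.KZ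
open Literature.NumberTheory.Transcendental.KZ.FormalPeriodRing

namespace Summit.KontsevichZagierPeriods.KontsevichZagierPeriods.Theorems

open SoloInformedQStep

/-! ## 1. The product representation -/

section prod

variable (M : ℕ) {m m' k k' : ℕ} (u v : List ℕ) (hu : MZV.IsAdmissible u)
  (hwu : MZV.weight u = m + 1) (hku : u.length = k + 1) (hv : MZV.IsAdmissible v)
  (hwv : MZV.weight v = m' + 1) (hkv : v.length = k' + 1) (hM : m + m' + 1 = M)

include hM in
/-- The dimension count `(m+1) + (m'+1) = M+1`. -/
theorem soloInformed_hDim2 : (m + 1) + (m' + 1) = M + 1 := by omega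

/-- `HProd2 = CubeW u × CubeW v`, relabelled to `Fin (M+1)`. -/
def soloInformedHProd2 : IntegralRep (M + 1) :=
  ((soloInformedCubeW u hu hwu).prod (soloInformedCubeW v hv hwv)).reindex
    (finCongr (soloInformed_hDim2 M hM))

/-- The domain of `HProd2` is the cube. -/
theorem soloInformed_hProd2_domain :
    (soloInformedHProd2 M u v hu hwu hv hwv hM).domain = soloInformedOpenCube (M + 1) := by
  ext w
  simp only [soloInformedHProd2, IntegralRep.reindex_domain, IntegralRep.prod_domain,
    IntegralRep.mem_prodDomain, mem_setOf_eq, soloInformedCubeW_domain]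
  constructor
  · rintro ⟨h1, h2⟩ l
    obtain ⟨i, rfl⟩ := (finCongr (soloInformed_hDim2 M hM)).surjective l
    induction i using Fin.addCases with
    | left i => exact h1 i
    | right j => exact h2 j
  · exact fun h => ⟨fun i => h _, fun j => h _⟩

/-- The chain `Q` of `u`-block-end prefix products of the `u`-half of a point. -/
def soloInformedQW (k : ℕ) (w : Fin (M + 1) → ℝ) : List ℝ :=
  List.ofFn fun s : Fin (k + 1) =>
    soloInformedPP (fun i : Fin (m + 1) => w (Fin.cast (soloInformed_hDim2 M hM) (Fin.castAdd (m' + 1) i)))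
      ((soloInformedEnds u).getD s 0 - 1)

/-- The chain `R` of `v`-block-end prefix products of the `v`-half of a point. -/
def soloInformedRW (k' : ℕ) (w : Fin (M + 1) → ℝ) : List ℝ :=
  List.ofFn fun s : Fin (k' + 1) =>
    soloInformedPP (fun j : Fin (m' + 1) => w (Fin.cast (soloInformed_hDim2 M hM) (Fin.natAdd (m + 1) j)))
      ((soloInformedEnds v).getD s 0 - 1)

/-- Lengths of the chains. -/
@[simp] theorem soloInformed_length_QW (w : Fin (M + 1) → ℝ) :
    (soloInformedQW M u hM k w).length = k + 1 := by
  simp [soloInformedQW]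

/-- Lengths of the chains. -/
@[simp] theorem soloInformed_length_RW (w : Fin (M + 1) → ℝ) :
    (soloInformedRW M v hM k' w).length = k' + 1 := by
  simp [soloInformedRW]

/-- On the cube the entries of `Q` lie in `[0,1)`. -/
theorem soloInformed_QW_mem {w : Fin (M + 1) → ℝ} (hwc : w ∈ soloInformedOpenCube (M + 1)) :
    ∀ q ∈ soloInformedQW M u hM k w, 0 ≤ q ∧ q < 1 := by
  intro q hq
  unfold soloInformedQW at hq
  rw [List.mem_ofFn] at hq
  obtain ⟨s, rfl⟩ := hq
  have h := soloInformedPP_mem_Ioo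
    (x := fun i : Fin (m + 1) => w (Fin.cast (soloInformed_hDim2 M hM) (Fin.castAdd (m' + 1) i)))
    (fun i => hwc _) ((soloInformedEnds u).getD s 0 - 1)
  exact ⟨h.1.le, h.2⟩

/-- On the cube the entries of `R` lie in `[0,1)`. -/
theorem soloInformed_RW_mem {w : Fin (M + 1) → ℝ} (hwc : w ∈ soloInformedOpenCube (M + 1)) :
    ∀ r ∈ soloInformedRW M v hM k' w, 0 ≤ r ∧ r < 1 := by
  intro r hr
  unfold soloInformedRW at hr
  rw [List.mem_ofFn] at hr
  obtain ⟨s, rfl⟩ := hr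
  have h := soloInformedPP_mem_Ioo
    (x := fun j : Fin (m' + 1) => w (Fin.cast (soloInformed_hDim2 M hM) (Fin.natAdd (m + 1) j)))
    (fun j => hwc _) ((soloInformedEnds v).getD s 0 - 1)
  exact ⟨h.1.le, h.2⟩

include hku hkv in
/-- **The integrand of `HProd2` is `G(Q) · G(R)`.** -/
theorem soloInformed_hProd2_integrand (w : Fin (M + 1) → ℝ) :
    (soloInformedHProd2 M u v hu hwu hv hwv hM).integrand w =
      soloInformedGQ (soloInformedQW M u hM k w) * soloInformedGQ (soloInformedRW M v hM k' w) := by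
  simp only [soloInformedHProd2, IntegralRep.reindex_integrand, IntegralRep.prod_integrand_eq,
    IntegralRep.prodFun_apply, soloInformedCubeW_integrand, finCongr_apply]
  rw [soloInformed_cubeWf_eq_GQ hu.1 hwu hku, soloInformed_cubeWf_eq_GQ hv.1 hwv hkv]
  rfl

/-- **`⟦HProd2⟧ = mzvClass u · mzvClass v`** (rule (2), Fubini). -/
theorem soloInformed_hProd2_class :
    toFormalPeriod (of (soloInformedHProd2 M u v hu hwu hv hwv hM)) = mzvClass u * mzvClass v := by
  rw [← soloInformed_cubeW_class u hu hwu, ← soloInformed_cubeW_class v hv hwv, ← map_mul, of_mul_of,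
    eq_comm, toFormalPeriod_eq_iff]
  exact of_sub_of_reindex_mem_relations _ _

end prod

/-! ## 2. The labelling of a word and its representation -/

section terms

variable (M : ℕ) {m m' k k' : ℕ} (u v : List ℕ) (hu : MZV.IsAdmissible u)
  (hwu : MZV.weight u = m + 1) (hku : u.length = k + 1) (hv : MZV.IsAdmissible v)
  (hwv : MZV.weight v = m' + 1) (hkv : v.length = k' + 1) (hM : m + m' + 1 = M)

/-- The block labelling of `Fin (M+1)` attached to a word: a `u`-coordinate of block `s` is
labelled by the position of the step consuming `u`-block `s`, and likewise for `v`. -/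
def soloInformedLabW (ω : List SoloInformedQStep) : Fin (M + 1) → ℕ :=
  soloInformedGlue (soloInformed_hDim2 M hM)
    (fun l : Fin (m + 1) => soloInformedPosG soloInformedIsA ω (soloInformedLabU u l))
    fun l : Fin (m' + 1) => soloInformedPosG soloInformedIsB ω (soloInformedLabU v l)

/-- A positive entry, read with `getD`. -/
theorem soloInformed_one_le_getD {u : List ℕ} (hpos : ∀ i ∈ u, 1 ≤ i) {c : ℕ} (hc : c < u.length) :
    1 ≤ u.getD c 0 := by
  rw [List.getD_eq_getElem _ _ hc]
  exact hpos _ (List.getElem_mem _)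

/-- The head of an admissible nonempty index, read with `getD`, is `≥ 2`. -/
theorem soloInformed_two_le_getD_zero {u : List ℕ} (hu : MZV.IsAdmissible u) (hne : u ≠ []) :
    2 ≤ u.getD 0 0 := by
  have h := hu.2 hne
  rw [List.head_eq_getElem] at h
  rwa [List.getD_eq_getElem _ _ (List.length_pos_of_ne_nil hne)]

/-- If step `t` consumes a block of the kind, fewer than all blocks were consumed before. -/
theorem soloInformed_countP_take_lt (isX : SoloInformedQStep → Bool) (ω : List SoloInformedQStep)
    {K t : ℕ} (hω : ω.countP (isX ·) = K) (ht : t < ω.length) (hX : isX ω[t] = true) :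
    (ω.take t).countP (isX ·) < K := by
  have h1 := soloInformed_countP_take_succ isX ω ht
  have h2 := soloInformed_countP_take_le isX ω (t + 1)
  rw [if_pos hX] at h1
  omega

include hu hwu hku hv hwv hkv in
/-- **The fibres of `LabW ω`:** over position `t` there are
`[A-ish] u_{c^A_t} + [B-ish] v_{c^B_t}` coordinates. -/
theorem soloInformed_fib_labW {ω : List SoloInformedQStep}
    (hω : ω ∈ soloInformedQSh (k + 1) (k' + 1)) {t : ℕ} (ht : t < ω.length) :
    soloInformedFib (soloInformedLabW M u v hM ω) t =
      (if soloInformedIsA ω[t] then u.getD (soloInformedCntA (ω.take t)) 0 else 0) +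
        (if soloInformedIsB ω[t] then v.getD (soloInformedCntB (ω.take t)) 0 else 0) := by
  obtain ⟨hA, hB⟩ := soloInformed_mem_qSh.1 hω
  unfold soloInformedFib soloInformedLabW
  rw [soloInformed_card_filter_glue_eq, soloInformed_card_fibre_posG hu.1 hwu hku soloInformedIsA ω hA ht,
    soloInformed_card_fibre_posG hv.1 hwv hkv soloInformedIsB ω hB ht]
  rfl

include hu hwu hku hv hwv hkv in
/-- **`LabW ω` is a valid block labelling** with blocks `0, …, |ω| − 1`. -/
theorem soloInformed_isLab_labW {ω : List SoloInformedQStep}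
    (hω : ω ∈ soloInformedQSh (k + 1) (k' + 1)) :
    soloInformedIsLab (soloInformedLabW M u v hM ω) (ω.length - 1) := by
  obtain ⟨hA, hB⟩ := soloInformed_mem_qSh.1 hω
  have hne : ω ≠ [] := by rintro rfl; simp at hA
  have hlen := List.length_pos_of_ne_nil hne
  have hune : u ≠ [] := List.ne_nil_of_length_eq_add_one hku
  have hvne : v ≠ [] := List.ne_nil_of_length_eq_add_one hkv
  refine ⟨fun L => ?_, fun t ht => ?_, ?_⟩
  · exact soloInformed_glue_le _ _ _
      (fun l => soloInformed_posG_labU_le hu.1 hwu hku soloInformedIsA ω hA l)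
      (fun l => soloInformed_posG_labU_le hv.1 hwv hkv soloInformedIsB ω hB l) L
  · have ht' : t < ω.length := by omega
    rw [soloInformed_fib_labW M u v hu hwu hku hv hwv hkv hM hω ht']
    have hcA := fun hX => soloInformed_countP_take_lt soloInformedIsA ω hA ht' hX
    have hcB := fun hX => soloInformed_countP_take_lt soloInformedIsB ω hB ht' hX
    have hstep : soloInformedIsA ω[t] = true ∨ soloInformedIsB ω[t] = true := by
      cases ω[t] <;> simp [soloInformedIsA, soloInformedIsB]
    rcases hstep with hX | hX
    · have := soloInformed_one_le_getD hu.1 (show soloInformedCntA (ω.take t) < u.length by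
        rw [hku]; exact hcA hX)
      rw [if_pos hX]
      omega
    · have := soloInformed_one_le_getD hv.1 (show soloInformedCntB (ω.take t) < v.length by
        rw [hkv]; exact hcB hX)
      rw [if_pos hX]
      omega
  · rw [soloInformed_fib_labW M u v hu hwu hku hv hwv hkv hM hω hlen]
    simp only [List.take_zero, soloInformed_cntA_nil, soloInformed_cntB_nil]
    have h2u := soloInformed_two_le_getD_zero hu hune
    have h2v := soloInformed_two_le_getD_zero hv hvne
    have hstep : soloInformedIsA ω[0] = true ∨ soloInformedIsB ω[0] = true := by
      cases ω[0] <;> simp [soloInformedIsA, soloInformedIsB]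
    rcases hstep with hX | hX <;> rw [if_pos hX] <;> omega

include hu hwu hku hv hwv hkv in
/-- **The chain products of `LabW ω` are the entries of `chain_ω(Q, R)`.** -/
theorem soloInformed_BP_labW {ω : List SoloInformedQStep}
    (hω : ω ∈ soloInformedQSh (k + 1) (k' + 1)) (w : Fin (M + 1) → ℝ) (t : ℕ) :
    soloInformedBP (soloInformedLabW M u v hM ω) w t =
      soloInformedQV (soloInformedQW M u hM k w) (soloInformedCntA (ω.take (t + 1))) *
        soloInformedQV (soloInformedRW M v hM k' w) (soloInformedCntB (ω.take (t + 1))) := by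
  obtain ⟨hA, hB⟩ := soloInformed_mem_qSh.1 hω
  unfold soloInformedBP soloInformedLabW
  rw [soloInformed_prod_filter_glue_le,
    soloInformed_prod_filter_posG_le hu.1 hwu hku soloInformedIsA ω hA
      (fun i : Fin (m + 1) => w (Fin.cast (soloInformed_hDim2 M hM) (Fin.castAdd (m' + 1) i))) t,
    soloInformed_prod_filter_posG_le hv.1 hwv hkv soloInformedIsB ω hB
      (fun j : Fin (m' + 1) => w (Fin.cast (soloInformed_hDim2 M hM) (Fin.natAdd (m + 1) j))) t]
  rfl

/-- The term representation `HTerm ω = BRep (LabW ω)` of a quasi-shuffle word. -/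
def soloInformedHTerm (ω : ↥(soloInformedQSh (k + 1) (k' + 1))) : IntegralRep (M + 1) :=
  soloInformedBRep (soloInformedLabW M u v hM ω.1)
    (soloInformed_isLab_labW M u v hu hwu hku hv hwv hkv hM ω.2)

/-- **The integrand of `HTerm ω` is `G(chain_ω(Q, R))`.** -/
theorem soloInformed_hTerm_integrand (ω : ↥(soloInformedQSh (k + 1) (k' + 1))) (w : Fin (M + 1) → ℝ) :
    (soloInformedHTerm M u v hu hwu hku hv hwv hkv hM ω).integrand w =
      soloInformedGQ (soloInformedChainW (soloInformedQW M u hM k w) (soloInformedRW M v hM k' w) 0 0 ω.1) := by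
  have hA := (soloInformed_mem_qSh.1 ω.2).1
  have hne : ω.1 ≠ [] := by intro h; rw [h] at hA; simp at hA
  have hlen := List.length_pos_of_ne_nil hne
  rw [soloInformedHTerm, soloInformed_bRep_integrand, soloInformed_chainW_eq_ofFn]
  congr 1
  apply List.ext_getElem
  · simp only [List.length_ofFn]
    omega
  · intro t h1 h2
    rw [List.getElem_ofFn, List.getElem_ofFn, zero_add, zero_add]
    exact soloInformed_BP_labW M u v hu hwu hku hv hwv hkv hM ω.2 w t

/-- **`⟦HTerm ω⟧ = mzvClass (idxW u v ω)`.** -/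
theorem soloInformed_hTerm_class (ω : ↥(soloInformedQSh (k + 1) (k' + 1))) :
    toFormalPeriod (of (soloInformedHTerm M u v hu hwu hku hv hwv hkv hM ω)) =
      mzvClass (soloInformedIdxW u v 0 0 ω.1) := by
  have hA := (soloInformed_mem_qSh.1 ω.2).1
  have hne : ω.1 ≠ [] := by intro h; rw [h] at hA; simp at hA
  have hlen := List.length_pos_of_ne_nil hne
  rw [soloInformedHTerm, soloInformed_bRep_class, soloInformed_idxW_eq_ofFn]
  congr 1
  unfold soloInformedIdx
  apply List.ext_getElem
  · simp only [List.length_ofFn]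
    omega
  · intro t h1 h2
    have ht : t < ω.1.length := by simpa using h2
    rw [List.getElem_ofFn, List.getElem_ofFn]
    dsimp only
    rw [soloInformed_fib_labW M u v hu hwu hku hv hwv hkv hM ω.2 ht, zero_add, zero_add,
      List.getD_eq_getElem _ _ ht]

/-- The domain of `HTerm ω` is the cube. -/
theorem soloInformed_hTerm_domain (ω : ↥(soloInformedQSh (k + 1) (k' + 1))) :
    (soloInformedHTerm M u v hu hwu hku hv hwv hkv hM ω).domain = soloInformedOpenCube (M + 1) :=
  soloInformed_bRep_domain _ _

/-! ## 3. Rule (1b) and the raw formula -/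

/-- **Pointwise on the cube, `HProd2 = Σ_ω HTerm ω`** — the two-chain identity of file 2. -/
theorem soloInformed_hProd2_integrand_eq_sum {w : Fin (M + 1) → ℝ}
    (hwc : w ∈ soloInformedOpenCube (M + 1)) :
    (soloInformedHProd2 M u v hu hwu hv hwv hM).integrand w =
      ∑ ω : ↥(soloInformedQSh (k + 1) (k' + 1)),
        (soloInformedHTerm M u v hu hwu hku hv hwv hkv hM ω).integrand w := by
  simp only [soloInformed_hTerm_integrand]
  rw [Finset.sum_coe_sort (soloInformedQSh (k + 1) (k' + 1)) fun ω =>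
      soloInformedGQ (soloInformedChainW (soloInformedQW M u hM k w) (soloInformedRW M v hM k' w) 0 0 ω),
    soloInformed_sum_GQ_chainW k k' _ _ (soloInformed_length_QW M u hM w)
      (soloInformed_length_RW M v hM w) (soloInformed_QW_mem M u hM hwc) (soloInformed_RW_mem M v hM hwc),
    soloInformed_hProd2_integrand M u v hu hwu hku hv hwv hkv hM]

/-- **Rule (1b): `⟦HProd2⟧ − Σ_ω ⟦HTerm ω⟧ ∈ relations`.** -/
theorem soloInformed_hProd2_move :
    of (soloInformedHProd2 M u v hu hwu hv hwv hM) -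
        ∑ ω : ↥(soloInformedQSh (k + 1) (k' + 1)),
          of (soloInformedHTerm M u v hu hwu hku hv hwv hkv hM ω) ∈ relations := by
  have e := (soloInformedQSh (k + 1) (k' + 1)).equivFin.symm
  have h := soloInformed_of_sub_sum_mem_relations (soloInformedHProd2 M u v hu hwu hv hwv hM)
    (fun i => soloInformedHTerm M u v hu hwu hku hv hwv hkv hM (e i))
    (fun i => by rw [soloInformed_hProd2_domain]; exact soloInformed_hTerm_domain M u v hu hwu hku hv hwv hkv hM _)
    (fun w hwc => by
      rw [soloInformed_hProd2_domain] at hwc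
      dsimp only
      rw [Equiv.sum_comp e fun ω => (soloInformedHTerm M u v hu hwu hku hv hwv hkv hM ω).integrand w]
      exact soloInformed_hProd2_integrand_eq_sum M u v hu hwu hku hv hwv hkv hM hwc)
  rwa [Equiv.sum_comp e fun ω => of (soloInformedHTerm M u v hu hwu hku hv hwv hkv hM ω)] at h

end terms

section raw

variable {m m' k k' : ℕ} {u v : List ℕ} (hu : MZV.IsAdmissible u) (hwu : MZV.weight u = m + 1)
  (hku : u.length = k + 1) (hv : MZV.IsAdmissible v) (hwv : MZV.weight v = m' + 1)
  (hkv : v.length = k' + 1)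

include hu hwu hku hv hwv hkv in
/-- **The harmonic product in `𝒫`, raw form.** For admissible `u` of depth `k+1` and `v` of depth
`k'+1`,

  `mzvClass u · mzvClass v = Σ_{ω ∈ QSh (k+1) (k'+1)} mzvClass (idxW u v ω)`,

the sum over all quasi-shuffle words, by the three naive rules only. -/
theorem soloInformed_mzvClass_mul_qSh_raw :
    mzvClass u * mzvClass v =
      ∑ ω ∈ soloInformedQSh (k + 1) (k' + 1), mzvClass (soloInformedIdxW u v 0 0 ω) := by
  have h := toFormalPeriod_eq_iff.2
    (soloInformed_hProd2_move (m + m' + 1) u v hu hwu hku hv hwv hkv rfl)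
  rw [soloInformed_hProd2_class, map_sum] at h
  rw [h]
  simp only [soloInformed_hTerm_class]
  exact Finset.sum_coe_sort (soloInformedQSh (k + 1) (k' + 1))
    fun ω => mzvClass (soloInformedIdxW u v 0 0 ω)

end raw

end Summit.KontsevichZagierPeriods.KontsevichZagierPeriods.Theorems
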